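import Summits.ABC.StewartYu.PadicG3Setup
import Summits.ABC.StewartYu.PadicTwistSeries
import Summits.ABC.StewartYu.PadicExpOddPrime
import HarnessLib

/-!
# Cell abc-stewartyu, crux `Y07Odd` (stmt-ABC-19658), line `gen3-slab-odd`: the RADIUS of the Gen-3 class functions —
# `exp(c z)` at depth `m + 1` (`‖c‖ ≤ p^{−(m+1)}`) lives on the disc `‖z‖ < p^m √p`

`Summits/ABC/StewartYu/PadicG3Radius.lean` — cell `abc-stewartyu` (K-M3.1: HOME/p2/K-M3-1-ledger-p2.md §2, HOME/p1/K-M3-1-padic-ledger.md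
(Y18); seat p2-g4, F-odd lead).  Theorems only; no named fact.  On the slab class of `PadicG3Slab` the RELATIVE exponents
`c = zexpo(uᵢ − u_{i₀})` (odd `p`: `Lsum(λ − λ♭)` up to the `Λ`-term) have `‖c‖ ≤ p^{−(m+1)}` (`G3Setup.IsSlab`); this file is the
analytic counterpart of that congruence: the one-variable exponentials `z ↦ exp(c z)` are then analytic, of norm `1` at the integer
nodes, and have power-series coefficients weighted-bounded by `1` at the radius `ρ = p^m √p` — so the landed Schwarz/Newton layer
(`PadicNewton.norm_tsum_le_max_of_small_jets_levels`, any `ρ > r`) yields the gain `(m + ½) log p` PER ZERO at the integer nodes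
(`r = 1`), which is what turns `(c·n/log p)ⁿ` into `cⁿ` (Yu 1999, p. 340).  The proofs are the depth-`1` ones of
`PadicTwistFunctions`/`PadicTwistSeries` (M2) after the scaling `z ↦ p^{−m} z`, `c ↦ p^m c` in norm.

* `mem_eball_of_norm_mul_lt` / `hasDerivAt_exp_mul_of_norm_mul_lt` / `analyticAt_exp_mul_of_norm_mul_lt` — for `‖z‖·‖c‖ < (√p)⁻¹`;
* `hasDerivAt_exp_mul_depth`, `analyticAt_exp_mul_depth` — for `‖c‖ ≤ p⁻¹^(m+1)`, `‖z‖ < p^m √p`;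
* `norm_exp_intCast_mul_depth` — `‖exp(x c)‖ = 1` at an integer `x`;
* `norm_pow_div_factorial_mul_le_depth` — `‖c^j / j!‖ · (p^m √p)^j ≤ 1` (the `WtBdd` input at radius `p^m √p`).

WHAT THIS IS NOT: no functions of the frame yet (`PadicG3Functions`); no crux moves.

References: K. Yu, Acta Arith. 89 (1999), p. 340, §10; K. Yu, Compositio 74 (1990) §1.1; K-M3.1 ledgers (cell).
-/

noncomputable section

open NormedSpace Metric
open scoped Nat
open Literature.NumberTheory.Transcendental

namespace Summit.ABC.StewartYu

namespace G3Setup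

variable {p : ℕ} [Fact p.Prime] (S : G3Setup p)

/-- `0 < √p`. [folklore] -/
theorem sqrt_p_pos (S : G3Setup p) : 0 < Real.sqrt p := Real.sqrt_pos.mpr S.p_pos

/-- `√p · √p = p`. [folklore] -/
theorem sqrt_p_mul_self (S : G3Setup p) : Real.sqrt p * Real.sqrt p = p := Real.mul_self_sqrt S.p_pos.le

/-- For `‖z‖·‖c‖ < (√p)⁻¹` the point `c z` lies in the disc of convergence of `exp`. [cite: Yu1990, §1.1] -/
theorem mem_eball_of_norm_mul_lt (S : G3Setup p) {c z : ℚ_[p]} (h : ‖z‖ * ‖c‖ < (Real.sqrt p)⁻¹) :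
    z • c ∈ eball (0 : ℚ_[p]) (expSeries ℚ_[p] ℚ_[p]).radius := by
  rw [mem_eball_zero_iff]
  refine lt_of_lt_of_le ?_ (PadicExp.inv_sqrt_le_expSeries_radius (ℓ := p) S.hp3)
  rw [enorm_eq_nnnorm, ENNReal.coe_lt_coe, ← NNReal.coe_lt_coe, coe_nnnorm, NNReal.coe_inv,
    Real.coe_sqrt, NNReal.coe_natCast, smul_eq_mul, norm_mul]
  exact h

/-- `d/dz exp(c z) = c exp(c z)` whenever `‖z‖·‖c‖ < (√p)⁻¹`. [cite: Yu1990, §1.1] -/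
theorem hasDerivAt_exp_mul_of_norm_mul_lt (S : G3Setup p) {c z : ℚ_[p]} (h : ‖z‖ * ‖c‖ < (Real.sqrt p)⁻¹) :
    HasDerivAt (fun x : ℚ_[p] => exp (c * x)) (c * exp (c * z)) z := by
  have hd := hasDerivAt_exp_smul_const_of_mem_ball' (𝕂 := ℚ_[p]) c z (S.mem_eball_of_norm_mul_lt h)
  have e1 : (fun u : ℚ_[p] => exp (u • c)) = fun u : ℚ_[p] => exp (c * u) := by
    funext u; rw [smul_eq_mul, mul_comm]
  rw [e1, smul_eq_mul, mul_comm z c] at hd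
  exact hd

/-- `z ↦ exp(c z)` is analytic at `z` whenever `‖z‖·‖c‖ < (√p)⁻¹`. [cite: Yu1990, §1.1] -/
theorem analyticAt_exp_mul_of_norm_mul_lt (S : G3Setup p) {c z : ℚ_[p]} (h : ‖z‖ * ‖c‖ < (Real.sqrt p)⁻¹) :
    AnalyticAt ℚ_[p] (fun x : ℚ_[p] => exp (c * x)) z := by
  have h1 : AnalyticAt ℚ_[p] (exp : ℚ_[p] → ℚ_[p]) (c * z) := by
    refine analyticAt_exp_of_mem_ball (c * z) ?_
    have := S.mem_eball_of_norm_mul_lt h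
    rwa [smul_eq_mul, mul_comm] at this
  have h2 : AnalyticAt ℚ_[p] (fun x : ℚ_[p] => c * x) z := by fun_prop
  exact h1.comp h2

/-- The depth-`m+1` bound implies the product bound on the big disc: `‖c‖ ≤ p⁻¹^(m+1)`, `‖z‖ < p^m √p` ⇒
`‖z‖·‖c‖ < (√p)⁻¹`. [folklore] -/
theorem norm_mul_lt_of_depth (S : G3Setup p) (m : ℕ) {c z : ℚ_[p]} (hc : ‖c‖ ≤ (p : ℝ)⁻¹ ^ (m + 1))
    (hz : ‖z‖ < (p : ℝ) ^ m * Real.sqrt p) : ‖z‖ * ‖c‖ < (Real.sqrt p)⁻¹ := by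
  have hp0 : (0 : ℝ) < p := S.p_pos
  have hsq : 0 < Real.sqrt p := S.sqrt_p_pos
  rcases eq_or_lt_of_le (norm_nonneg c) with h0 | hcpos
  · rw [← h0, mul_zero]; exact inv_pos.mpr hsq
  calc ‖z‖ * ‖c‖ < (p : ℝ) ^ m * Real.sqrt p * ‖c‖ := mul_lt_mul_of_pos_right hz hcpos
    _ ≤ (p : ℝ) ^ m * Real.sqrt p * ((p : ℝ)⁻¹ ^ (m + 1)) := mul_le_mul_of_nonneg_left hc (by positivity)
    _ = (Real.sqrt p)⁻¹ := by
        have hs : Real.sqrt p ≠ 0 := hsq.ne'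
        have hpm : (p : ℝ) ^ m ≠ 0 := pow_ne_zero _ hp0.ne'
        rw [inv_pow, pow_succ, mul_inv]
        refine eq_inv_of_mul_eq_one_left ?_
        calc (p : ℝ) ^ m * Real.sqrt p * (((p : ℝ) ^ m)⁻¹ * (p : ℝ)⁻¹) * Real.sqrt p
            = ((p : ℝ) ^ m * ((p : ℝ) ^ m)⁻¹) * ((Real.sqrt p * Real.sqrt p) * (p : ℝ)⁻¹) := by ring
          _ = 1 := by rw [mul_inv_cancel₀ hpm, S.sqrt_p_mul_self, mul_inv_cancel₀ hp0.ne', one_mul]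

/-- **`d/dz exp(c z) = c exp(c z)` on the big disc** `‖z‖ < p^m √p` for a depth-`m+1` exponent `‖c‖ ≤ p^{−(m+1)}`.
[cite: Yu1999, §10 (10.15)] -/
theorem hasDerivAt_exp_mul_depth (S : G3Setup p) (m : ℕ) {c z : ℚ_[p]} (hc : ‖c‖ ≤ (p : ℝ)⁻¹ ^ (m + 1))
    (hz : ‖z‖ < (p : ℝ) ^ m * Real.sqrt p) :
    HasDerivAt (fun x : ℚ_[p] => exp (c * x)) (c * exp (c * z)) z :=
  S.hasDerivAt_exp_mul_of_norm_mul_lt (S.norm_mul_lt_of_depth m hc hz)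

/-- **Analyticity on the big disc.** [cite: Yu1999, §10 (10.15)] -/
theorem analyticAt_exp_mul_depth (S : G3Setup p) (m : ℕ) {c z : ℚ_[p]} (hc : ‖c‖ ≤ (p : ℝ)⁻¹ ^ (m + 1))
    (hz : ‖z‖ < (p : ℝ) ^ m * Real.sqrt p) :
    AnalyticAt ℚ_[p] (fun x : ℚ_[p] => exp (c * x)) z :=
  S.analyticAt_exp_mul_of_norm_mul_lt (S.norm_mul_lt_of_depth m hc hz)

/-- A depth-`m+1` exponent is a depth-`1` exponent. [folklore] -/
theorem norm_le_inv_p_of_depth (S : G3Setup p) (m : ℕ) {c : ℚ_[p]} (hc : ‖c‖ ≤ (p : ℝ)⁻¹ ^ (m + 1)) : ‖c‖ ≤ (p : ℝ)⁻¹ := by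
  refine hc.trans ?_
  rw [pow_succ]
  exact mul_le_of_le_one_left (inv_nonneg.mpr S.p_pos.le)
    (pow_le_one₀ (inv_nonneg.mpr S.p_pos.le) (inv_le_one_of_one_le₀ S.one_lt_p.le))

/-- **At an integer node the exponential is a unit**: `‖exp(x c)‖ = 1`. [cite: Yu1990, §1.1] -/
theorem norm_exp_intCast_mul_depth (S : G3Setup p) (m : ℕ) {c : ℚ_[p]} (hc : ‖c‖ ≤ (p : ℝ)⁻¹ ^ (m + 1)) (x : ℤ) :
    ‖exp ((x : ℚ_[p]) * c)‖ = 1 := by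
  have hp2 : p ≠ 2 := by have := S.hp3; omega
  refine PadicExpOdd.norm_exp_of_le (ℓ := p) hp2 ?_
  rw [norm_mul]
  calc ‖(x : ℚ_[p])‖ * ‖c‖ ≤ 1 * (p : ℝ)⁻¹ :=
        mul_le_mul (Padic.norm_int_le_one _) (S.norm_le_inv_p_of_depth m hc) (norm_nonneg _) zero_le_one
    _ = (p : ℝ)⁻¹ := one_mul _

/-- `‖(j!)⁻¹‖ ≤ (√p)^j` (odd `p`). [folklore] -/
theorem norm_inv_factorial_le_sqrt_pow (S : G3Setup p) (j : ℕ) : ‖((j ! : ℕ) : ℚ_[p])⁻¹‖ ≤ Real.sqrt p ^ j := by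
  have h2 := PadicExp.norm_inv_natCast_factorial_sq_le (E := ℚ_[p]) (ℓ := p) S.hp3 j
  have hp0 : (0 : ℝ) ≤ p := S.p_pos.le
  have h3 : ‖((j ! : ℕ) : ℚ_[p])⁻¹‖ ^ 2 ≤ (Real.sqrt p ^ j) ^ 2 := by
    rw [← pow_mul, mul_comm, pow_mul, Real.sq_sqrt hp0]
    exact h2.trans (pow_le_pow_right₀ S.one_lt_p.le (Nat.sub_le j 1))
  exact (pow_le_pow_iff_left₀ (norm_nonneg _) (by positivity) two_ne_zero).mp h3

/-- **The weighted coefficient bound at the big radius**: `‖c^j / j!‖ · (p^m √p)^j ≤ 1` for `‖c‖ ≤ p^{−(m+1)}` — the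
`WtBdd (p^m √p)` input of the Schwarz/Newton layer for the class functions. [cite: Yu1999, §10 (10.15)–(10.19)] -/
theorem norm_pow_div_factorial_mul_le_depth (S : G3Setup p) (m : ℕ) {c : ℚ_[p]} (hc : ‖c‖ ≤ (p : ℝ)⁻¹ ^ (m + 1)) (j : ℕ) :
    ‖c ^ j / (j ! : ℚ_[p])‖ * ((p : ℝ) ^ m * Real.sqrt p) ^ j ≤ 1 := by
  have hp0 : (0 : ℝ) < p := S.p_pos
  rw [div_eq_mul_inv, norm_mul, norm_pow, show ((j ! : ℚ_[p])) = ((j ! : ℕ) : ℚ_[p]) by norm_cast]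
  have h1 : ‖c‖ ^ j ≤ ((p : ℝ)⁻¹ ^ (m + 1)) ^ j := pow_le_pow_left₀ (norm_nonneg _) hc j
  have h2 := S.norm_inv_factorial_le_sqrt_pow j
  have hsq : Real.sqrt p ^ j * Real.sqrt p ^ j = (p : ℝ) ^ j := by rw [← mul_pow, S.sqrt_p_mul_self]
  calc ‖c‖ ^ j * ‖((j ! : ℕ) : ℚ_[p])⁻¹‖ * ((p : ℝ) ^ m * Real.sqrt p) ^ j
      ≤ ((p : ℝ)⁻¹ ^ (m + 1)) ^ j * Real.sqrt p ^ j * ((p : ℝ) ^ m * Real.sqrt p) ^ j := by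
        refine mul_le_mul_of_nonneg_right (mul_le_mul h1 h2 (norm_nonneg _) (by positivity)) (by positivity)
    _ = 1 := by
        rw [mul_pow, mul_assoc, mul_left_comm (Real.sqrt p ^ j), ← mul_assoc, ← mul_assoc, mul_assoc _ (Real.sqrt p ^ j), hsq,
          ← mul_pow, ← mul_pow, pow_succ, inv_pow]
        have : ((p : ℝ) ^ m)⁻¹ * (p : ℝ)⁻¹ * (p : ℝ) ^ m * p = 1 := by field_simp
        rw [this, one_pow]

end G3Setup

end Summit.ABC.StewartYu

end
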